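import Summits.QuantumFields.GaugeBoot.TiltedBoxLimitPermutations
import Mathlib.Algebra.Pointwise.Stabilizer
import Mathlib.GroupTheory.Perm.Sign
import Mathlib.GroupTheory.Perm.Support
import HarnessLib

/-!
# Infinite-volume limit points of the 45°-tilted boxes, part 14: the full axis-permutation symmetry

HONEST FRAMING (cell `pub-gaugeboot`, page 1 of every file): the venture produces certified bounds
on lattice expectations at stated coupling, gauge group, dimension and torus size; NOT a mass gap,
NOT a continuum limit, NOT a string tension; NOT Yang–Mills-summit-bearing (barriers
`FixedCouplingUltralocality`, `PerturbativeInvisibility`). A structural symmetry fact about a class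
of infinite-volume Wilson states (which axis permutations a tilted-box SDP may quotient by); nothing
else is claimed.

## Content

Parts 3 and 12 (`TiltedBoxLimitInvariance.lean`, `TiltedBoxLimitPermutations.lean`) give invariance of
every tilted limit point `μ ∈ tiltedBoxLimitPoints d i j ρ β` under the axis transposition `(i j)`
and under the transpositions `(k l)` of transverse axes `k, l ∉ {i, j}`, and announce — without
proof — that "together these generate the stabiliser of the pair `{i, j}`". This file spells the
generation statement out and draws the consequence:

* `Perm.mem_stabilizer_pair_iff` — `σ` lies in the setwise stabiliser
  `MulAction.stabilizer (Equiv.Perm α) {a, b}` iff `σ` fixes `a` and `b` or exchanges them;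
* `Perm.swap_induction_of_apply_eq`, **`Perm.swap_induction_of_mem_stabilizer_pair`** — induction
  principles: a permutation fixing `a` and `b` is a product of transpositions `(x y)` with
  `x, y ∉ {a, b}` (restriction to the complement, `Equiv.Perm.swap_induction_on` there, and
  `Equiv.Perm.ofSubtype_subtypePerm`); a member of the stabiliser is such a product, possibly
  preceded by `(a b)`;
* `Perm.closure_swaps_pair_eq_stabilizer` — the literal group identity
  `⟨(a b), (x y) : x, y ∉ {a, b}⟩ = Stab_{Perm α}({a, b})` (for a finite type `α`);
* `configPerm_one`, `configPerm_mul` — `σ ↦ configPerm σ` is multiplicative, so the axis permutations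
  preserving a given measure on `ℤ^d` configurations are closed under products
  (`measurePreserving_configPerm_of_mem_stabilizer_pair`: `(i j)` and the transverse transpositions
  suffice for the whole stabiliser);
* **`measurePreserving_configPerm_of_mem_tiltedBoxLimitPoints`** — every tilted limit point of the
  plane `(i, j)` (`i ≠ j`, compact Hausdorff second countable `G`, continuous `ρ`, every real `β`) is
  invariant under `configPerm σ` for EVERY axis permutation `σ` with `σ{i, j} = {i, j}`; with the
  coordinate reflections of part 3 this is the subgroup `Stab({i, j}) ⋉ (ℤ/2)^d` of the hyperoctahedral
  group `B_d` — the axis symmetry a loop-equation SDP on the tilted family may quotient by while its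
  bound keeps an exact infinite-volume meaning (`integral_comp_configPerm_of_mem_tiltedBoxLimitPoints`).

NOT claimed: invariance under permutations moving the pair `{i, j}` (they carry the tilted family of
the plane `(i, j)` to that of another plane; whether the limit classes coincide is the uniqueness
question left open throughout this series).

References: J. Fröhlich, R. Israel, E. H. Lieb, B. Simon, J. Stat. Phys. 22 (1980) 297, §3 (the use);
the group theory is textbook (transpositions generate the symmetric group).
-/

noncomputable section

open MeasureTheory
open scoped Pointwise
open Literature.MathematicalPhysics.QuantumLattice

namespace Summit.QuantumFields.GaugeBoot

namespace TiltedRP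

/-! ## Group theory: the setwise stabiliser of a pair in a symmetric group -/

namespace Perm

open Equiv MulAction

variable {α : Type*} {a b : α}

/-- **Membership in the setwise stabiliser of a pair**: `σ{a, b} = {a, b}` iff `σ` fixes both points
or exchanges them. [folklore] -/
theorem mem_stabilizer_pair_iff {σ : Perm α} :
    σ ∈ stabilizer (Perm α) ({a, b} : Set α) ↔ σ a = a ∧ σ b = b ∨ σ a = b ∧ σ b = a := by
  rw [mem_stabilizer_set]
  simp only [Perm.smul_def, Set.mem_insert_iff, Set.mem_singleton_iff]
  constructor
  · intro h
    have ha := (h a).2 (Or.inl rfl)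
    have hb := (h b).2 (Or.inr rfl)
    rcases ha with ha | ha
    · refine Or.inl ⟨ha, ?_⟩
      rcases hb with hb | hb
      · have hba : b = a := σ.injective (hb.trans ha.symm)
        rw [hba]; exact ha
      · exact hb
    · rcases hb with hb | hb
      · exact Or.inr ⟨ha, hb⟩
      · have hab : a = b := σ.injective (ha.trans hb.symm)
        refine Or.inl ⟨?_, hb⟩
        rw [hab]; exact hb
  · rintro (⟨ha, hb⟩ | ⟨ha, hb⟩) c
    · refine ⟨?_, ?_⟩
      · rintro (h | h)
        · exact Or.inl (σ.injective (h.trans ha.symm))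
        · exact Or.inr (σ.injective (h.trans hb.symm))
      · rintro (rfl | rfl)
        exacts [Or.inl ha, Or.inr hb]
    · refine ⟨?_, ?_⟩
      · rintro (h | h)
        · exact Or.inr (σ.injective (h.trans hb.symm))
        · exact Or.inl (σ.injective (h.trans ha.symm))
      · rintro (rfl | rfl)
        exacts [Or.inr ha, Or.inl hb]

/-- The transposition `(a b)` stabilises `{a, b}`. [folklore] -/
theorem swap_mem_stabilizer_pair [DecidableEq α] (a b : α) :
    swap a b ∈ stabilizer (Perm α) ({a, b} : Set α) :=
  mem_stabilizer_pair_iff.2 (Or.inr ⟨swap_apply_left a b, swap_apply_right a b⟩)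

/-- A transposition `(x y)` with `x, y ∉ {a, b}` stabilises `{a, b}` (it fixes it pointwise).
[folklore] -/
theorem swap_mem_stabilizer_pair_of_ne [DecidableEq α] {x y : α} (hxa : x ≠ a) (hxb : x ≠ b)
    (hya : y ≠ a) (hyb : y ≠ b) : swap x y ∈ stabilizer (Perm α) ({a, b} : Set α) :=
  mem_stabilizer_pair_iff.2 (Or.inl ⟨swap_apply_of_ne_of_ne hxa.symm hya.symm,
    swap_apply_of_ne_of_ne hxb.symm hyb.symm⟩)

/-- Induction over the image of `Perm.ofSubtype`: a permutation of a subtype, pushed forward to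
`α`, is a product of transpositions of points of the subtype. [folklore] -/
theorem swap_induction_ofSubtype [DecidableEq α] [Finite α] {p : α → Prop} [DecidablePred p]
    {motive : Perm α → Prop} (one : motive 1)
    (step : ∀ (τ : Perm α) (x y : Subtype p), x ≠ y → motive τ → motive (swap (x : α) y * τ))
    (g : Perm (Subtype p)) : motive (Perm.ofSubtype g) := by
  induction g using Perm.swap_induction_on with
  | one => simpa only [map_one] using one
  | swap_mul f x y hxy hf =>
    rw [map_mul, Perm.ofSubtype_swap_eq]
    exact step _ x y hxy hf

/-- **Induction for permutations fixing two points**: if `σ a = a` and `σ b = b` then `σ` is a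
product of transpositions `(x y)` with `x, y ∉ {a, b}`, so any predicate containing `1` and stable
under left multiplication by such transpositions holds at `σ`. [folklore] -/
theorem swap_induction_of_apply_eq [DecidableEq α] [Finite α] {motive : Perm α → Prop}
    (σ : Perm α) (ha : σ a = a) (hb : σ b = b) (one : motive 1)
    (swap_off : ∀ (τ : Perm α) (x y : α), x ≠ a → x ≠ b → y ≠ a → y ≠ b → x ≠ y →
      motive τ → motive (swap x y * τ)) : motive σ := by
  have ea : ∀ x, σ x = a ↔ x = a := fun x => σ.injective.eq_iff' ha
  have eb : ∀ x, σ x = b ↔ x = b := fun x => σ.injective.eq_iff' hb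
  have h₁ : ∀ x, (σ x ≠ a ∧ σ x ≠ b) ↔ (x ≠ a ∧ x ≠ b) := fun x => by rw [Ne, Ne, ea, eb]
  have h₂ : ∀ x, σ x ≠ x → (x ≠ a ∧ x ≠ b) := fun x hx =>
    ⟨fun h => hx (by rw [h, ha]), fun h => hx (by rw [h, hb])⟩
  have hσ : Perm.ofSubtype (σ.subtypePerm (p := fun x => x ≠ a ∧ x ≠ b) h₁) = σ :=
    Perm.ofSubtype_subtypePerm h₁ h₂
  rw [← hσ]
  exact swap_induction_ofSubtype one
    (fun τ x y hxy hτ => swap_off τ x y x.2.1 x.2.2 y.2.1 y.2.2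
      (fun h => hxy (Subtype.ext h)) hτ) _

/-- **Induction for the setwise stabiliser of a pair**: a permutation `σ` with `σ{a, b} = {a, b}`
is a product of transpositions `(x y)`, `x, y ∉ {a, b}`, possibly followed (on the left) by `(a b)`;
so any predicate containing `1` and stable under left multiplication by `(a b)` and by those
transpositions holds on the whole stabiliser. This is the generation statement announced in
`TiltedBoxLimitPermutations.lean`. [folklore] -/
theorem swap_induction_of_mem_stabilizer_pair [DecidableEq α] [Finite α]
    {motive : Perm α → Prop} (σ : Perm α) (hσ : σ ∈ stabilizer (Perm α) ({a, b} : Set α))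
    (one : motive 1) (swap_pair : ∀ τ : Perm α, motive τ → motive (swap a b * τ))
    (swap_off : ∀ (τ : Perm α) (x y : α), x ≠ a → x ≠ b → y ≠ a → y ≠ b → x ≠ y →
      motive τ → motive (swap x y * τ)) : motive σ := by
  rcases mem_stabilizer_pair_iff.1 hσ with ⟨ha, hb⟩ | ⟨ha, hb⟩
  · exact swap_induction_of_apply_eq σ ha hb one swap_off
  · have hτa : (swap a b * σ) a = a := by rw [Perm.mul_apply, ha, swap_apply_right]
    have hτb : (swap a b * σ) b = b := by rw [Perm.mul_apply, hb, swap_apply_left]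
    have hστ : σ = swap a b * (swap a b * σ) := by rw [← mul_assoc, swap_mul_self, one_mul]
    rw [hστ]
    exact swap_pair _ (swap_induction_of_apply_eq _ hτa hτb one swap_off)

/-- **The generation statement as a group identity**: in the symmetric group of a finite type, the
transposition `(a b)` together with the transpositions `(x y)`, `x, y ∉ {a, b}`, generate exactly
the setwise stabiliser of `{a, b}`. [folklore] -/
theorem closure_swaps_pair_eq_stabilizer [DecidableEq α] [Finite α] (a b : α) :
    Subgroup.closure ({swap a b} ∪
        {τ : Perm α | ∃ x y : α, x ≠ a ∧ x ≠ b ∧ y ≠ a ∧ y ≠ b ∧ τ = swap x y}) =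
      stabilizer (Perm α) ({a, b} : Set α) := by
  apply le_antisymm
  · rw [Subgroup.closure_le]
    rintro τ (hτ | ⟨x, y, hxa, hxb, hya, hyb, rfl⟩)
    · rw [Set.mem_singleton_iff] at hτ
      rw [hτ]
      exact swap_mem_stabilizer_pair a b
    · exact swap_mem_stabilizer_pair_of_ne hxa hxb hya hyb
  · intro σ hσ
    exact swap_induction_of_mem_stabilizer_pair σ hσ (one_mem _)
      (fun τ hτ => mul_mem (Subgroup.subset_closure (Or.inl rfl)) hτ)
      fun τ x y hxa hxb hya hyb _ hτ =>
        mul_mem (Subgroup.subset_closure (Or.inr ⟨x, y, hxa, hxb, hya, hyb, rfl⟩)) hτ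

end Perm

/-! ## Axis permutations of configurations compose -/

section Config

variable {d : ℕ} {G : Type*}

/-- The identity permutation acts trivially on configurations. -/
@[simp] theorem configPerm_one : configPerm (G := G) (1 : Equiv.Perm (Fin d)) = id := by
  funext U e
  rfl

/-- `σ ↦ configPerm σ` is multiplicative: `configPerm (σ τ) = configPerm σ ∘ configPerm τ`. -/
theorem configPerm_mul (σ τ : Equiv.Perm (Fin d)) :
    configPerm (G := G) (σ * τ) = configPerm σ ∘ configPerm τ := by
  funext U e
  rfl

/-- `configPerm σ` is measurable. -/
theorem measurable_configPerm [MeasurableSpace G] (σ : Equiv.Perm (Fin d)) :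
    Measurable (configPerm (G := G) σ) :=
  measurable_pi_lambda _ fun _ => measurable_pi_apply _

/-- **`(i j)` and the transverse transpositions give the whole stabiliser**: if a measure on `ℤ^d`
configurations is invariant under `configPerm (i j)` and under `configPerm (k l)` for all
`k, l ∉ {i, j}`, it is invariant under `configPerm σ` for every axis permutation `σ` with
`σ{i, j} = {i, j}`. -/
theorem measurePreserving_configPerm_of_mem_stabilizer_pair [MeasurableSpace G] {i j : Fin d}
    {μ : Measure (LGConfig d G)}
    (hswap : MeasurePreserving (configPerm (G := G) (Equiv.swap i j)) μ μ)
    (htrans : ∀ k l : Fin d, k ≠ i → k ≠ j → l ≠ i → l ≠ j →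
      MeasurePreserving (configPerm (G := G) (Equiv.swap k l)) μ μ)
    {σ : Equiv.Perm (Fin d)}
    (hσ : σ ∈ MulAction.stabilizer (Equiv.Perm (Fin d)) ({i, j} : Set (Fin d))) :
    MeasurePreserving (configPerm (G := G) σ) μ μ := by
  refine Perm.swap_induction_of_mem_stabilizer_pair
    (motive := fun τ => MeasurePreserving (configPerm (G := G) τ) μ μ) σ hσ ?_ ?_ ?_
  · rw [configPerm_one]; exact MeasurePreserving.id μ
  · intro τ hτ
    rw [configPerm_mul]
    exact hswap.comp hτ
  · intro τ k l hki hkj hli hlj _ hτ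
    rw [configPerm_mul]
    exact (htrans k l hki hkj hli hlj).comp hτ

/-- Every Class-B state is invariant under every axis permutation (its `permInvariant` field);
recorded here only to contrast with the tilted class, where the stabiliser of `{i, j}` is what is
available. -/
theorem _root_.Summit.QuantumFields.GaugeBoot.ClassBState.measurePreserving_configPerm
    [Group G] [MeasurableSpace G] [TopologicalSpace G] {N : ℕ} {ρ : G →* Matrix (Fin N) (Fin N) ℂ}
    {β : ℝ} (ω : ClassBState d ρ β) (σ : Equiv.Perm (Fin d)) :
    MeasurePreserving (configPerm σ) ω.μ ω.μ :=
  ω.permInvariant σ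

end Config

/-! ## The tilted limit points -/

variable {d : ℕ} {i j : Fin d} {N : ℕ}
variable {G : Type*} [Group G] [TopologicalSpace G] [IsTopologicalGroup G] [CompactSpace G]
  [MeasurableSpace G] [BorelSpace G] [SecondCountableTopology G] [T2Space G]
variable (ρ : G →* Matrix (Fin N) (Fin N) ℂ)

/-- **Every tilted limit point is invariant under the whole stabiliser of `{i, j}`**: for `i ≠ j`,
compact Hausdorff second countable `G`, continuous `ρ`, every real `β`, every
`μ ∈ tiltedBoxLimitPoints d i j ρ β` and every axis permutation `σ` with `σ{i, j} = {i, j}`,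
`configPerm σ` preserves `μ`. -/
theorem measurePreserving_configPerm_of_mem_tiltedBoxLimitPoints (hij : i ≠ j) (hρ : Continuous ρ)
    {β : ℝ} {μ : Measure (LGConfig d G)} (hμ : μ ∈ tiltedBoxLimitPoints d i j ρ β)
    {σ : Equiv.Perm (Fin d)}
    (hσ : σ ∈ MulAction.stabilizer (Equiv.Perm (Fin d)) ({i, j} : Set (Fin d))) :
    MeasurePreserving (configPerm (G := G) σ) μ μ :=
  measurePreserving_configPerm_of_mem_stabilizer_pair
    (measurePreserving_configPerm_swap_of_mem_tiltedBoxLimitPoints ρ hij hρ hμ)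
    (fun _ _ hki hkj hli hlj =>
      measurePreserving_configPerm_swap_transverse_of_mem_tiltedBoxLimitPoints ρ hki hkj hli hlj hρ hμ)
    hσ

/-- The same, with the stabiliser condition spelled out: `σ` fixes `i` and `j` or exchanges them. -/
theorem measurePreserving_configPerm_of_mem_tiltedBoxLimitPoints' (hij : i ≠ j) (hρ : Continuous ρ)
    {β : ℝ} {μ : Measure (LGConfig d G)} (hμ : μ ∈ tiltedBoxLimitPoints d i j ρ β)
    {σ : Equiv.Perm (Fin d)} (hσ : σ i = i ∧ σ j = j ∨ σ i = j ∧ σ j = i) :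
    MeasurePreserving (configPerm (G := G) σ) μ μ :=
  measurePreserving_configPerm_of_mem_tiltedBoxLimitPoints ρ hij hρ hμ
    (Perm.mem_stabilizer_pair_iff.2 hσ)

/-- **Expectations are invariant**: `∫ F(configPerm σ U) dμ = ∫ F dμ` for every tilted limit point
`μ`, every `σ` in the stabiliser of `{i, j}` and every a.e.-strongly measurable `F`. -/
theorem integral_comp_configPerm_of_mem_tiltedBoxLimitPoints {E : Type*} [NormedAddCommGroup E]
    [NormedSpace ℝ E] (hij : i ≠ j) (hρ : Continuous ρ) {β : ℝ} {μ : Measure (LGConfig d G)}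
    (hμ : μ ∈ tiltedBoxLimitPoints d i j ρ β) {σ : Equiv.Perm (Fin d)}
    (hσ : σ ∈ MulAction.stabilizer (Equiv.Perm (Fin d)) ({i, j} : Set (Fin d)))
    {F : LGConfig d G → E} (hF : AEStronglyMeasurable F μ) :
    ∫ U, F (configPerm σ U) ∂μ = ∫ U, F U ∂μ := by
  have h := measurePreserving_configPerm_of_mem_tiltedBoxLimitPoints ρ hij hρ hμ hσ
  have hF' : AEStronglyMeasurable F (μ.map (configPerm (G := G) σ)) := by rwa [h.map_eq]
  rw [← integral_map h.measurable.aemeasurable hF', h.map_eq]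

end TiltedRP

end Summit.QuantumFields.GaugeBoot
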